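import Mathlib
import Summits.Ventures.HodgeRepro.CMType
import Summits.Ventures.HodgeRepro.HodgeSets
import Summits.Ventures.HodgeRepro.CMRank
import Summits.Ventures.HodgeRepro.Primitive
import Summits.Ventures.HodgeRepro.MuTable

/-!
# The columns of the μ-table (blind cell `pub-hodge-repro`, seat p2)

Column `s` of the μ-table `typeMatrix Φ` is the weight `weight Φ s = (g ↦ [s ∈ gΦ])` of the character
`x_s` on the Mumford–Tate torus.  Two columns `s`, `t` coincide iff `s⁻¹ t` lies in the right stabiliser
`rstab Φ = {h | Φ h = Φ}` of the CM type, i.e. iff `s` and `t` agree on the subfield `K^{rstab Φ}` from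
which `Φ` is induced.  Hence the μ-table has exactly `[G : rstab Φ]` distinct columns, each repeated
`|rstab Φ|` times, and a primitive type has pairwise distinct columns.

(Printed background: Dodson 1987 §1.1 p. 50 — the lift of a type `(K₁, Φ₁)` to `K`; Yanai 1985 §1 —
`H = {g : gS̃ = S̃}`; the typer's `Primitive.lean` records the model.)
-/

open Finset
open scoped Pointwise

namespace HodgeRepro

variable {G : Type*} [Group G] [DecidableEq G] [Fintype G]

omit [Fintype G] in
/-- Two columns of the μ-table coincide iff `s⁻¹ t` lies in the right stabiliser of `Φ`. -/
theorem weight_eq_weight_iff_mem_rstab (Φ : Finset G) (s t : G) :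
    weight Φ s = weight Φ t ↔ s⁻¹ * t ∈ rstab Φ := by
  have key : ∀ g : G, (s ∈ g • Φ ↔ t ∈ g • Φ) ↔ (g⁻¹ * t ∈ rmul Φ (s⁻¹ * t) ↔ g⁻¹ * t ∈ Φ) := by
    intro g
    rw [mem_rmul, ← inv_smul_mem_iff, ← inv_smul_mem_iff, smul_eq_mul, smul_eq_mul,
      _root_.mul_inv_rev, inv_inv, mul_assoc, mul_inv_cancel_left]
  constructor
  · intro h
    rw [mem_rstab]
    ext x
    have hx := congrFun h (t * x⁻¹)
    simp only [weight_apply] at hx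
    have : (s ∈ (t * x⁻¹) • Φ ↔ t ∈ (t * x⁻¹) • Φ) := by
      by_cases h1 : s ∈ (t * x⁻¹) • Φ <;> by_cases h2 : t ∈ (t * x⁻¹) • Φ <;> simp_all
    rw [key] at this
    simpa [_root_.mul_inv_rev, mul_assoc] using this
  · intro h
    rw [mem_rstab] at h
    ext g
    simp only [weight_apply]
    have : (s ∈ g • Φ ↔ t ∈ g • Φ) := by
      rw [key, h]
    simp only [this]

omit [Fintype G] in
/-- The weight map factors through `G ⧸ rstab Φ`: its kernel is the left-coset relation. -/
theorem ker_weight (Φ : Finset G) : Setoid.ker (weight Φ) = QuotientGroup.leftRel (rstab Φ) := by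
  ext s t
  rw [Setoid.ker_def, QuotientGroup.leftRel_apply, weight_eq_weight_iff_mem_rstab]

/-- The μ-table of `Φ` has exactly `[G : rstab Φ]` distinct columns (weights): the columns are indexed
by the embeddings of the subfield `K^{rstab Φ}` from which `Φ` is induced. -/
theorem card_image_weight_eq_index (Φ : Finset G) :
    (univ.image (weight Φ)).card = (rstab Φ).index := by
  classical
  rw [← Set.toFinset_range, Set.toFinset_card, ← Nat.card_eq_fintype_card,
    ← Nat.card_congr (Setoid.quotientKerEquivRange (weight Φ)), ker_weight, Subgroup.index_eq_card]
  rfl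

/-- Each weight of `Φ` is attained by exactly `|rstab Φ|` characters `x_s`. -/
theorem card_filter_weight_eq (Φ : Finset G) (s : G) :
    (univ.filter fun t => weight Φ t = weight Φ s).card = Nat.card (rstab Φ) := by
  classical
  have h : (univ.filter fun t => weight Φ t = weight Φ s) =
      (univ.filter fun h => h ∈ rstab Φ).image (fun h => s * h) := by
    ext t
    simp only [mem_filter, mem_univ, true_and, mem_image]
    constructor
    · intro ht
      refine ⟨s⁻¹ * t, ?_, by simp⟩
      rw [← weight_eq_weight_iff_mem_rstab]
      exact ht.symm
    · rintro ⟨h, hh, rfl⟩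
      rw [weight_eq_weight_iff_mem_rstab]
      simpa using hh
  rw [h, card_image_of_injective _ (mul_right_injective s), Nat.card_eq_fintype_card,
    Fintype.card_subtype]

omit [Fintype G] in
/-- A primitive CM type has pairwise distinct columns in its μ-table. -/
theorem weight_injective_of_isPrimitive {Φ : Finset G} (hΦ : IsPrimitive Φ) :
    Function.Injective (weight Φ) := by
  intro s t h
  rw [weight_eq_weight_iff_mem_rstab] at h
  have := hΦ _ h
  rwa [inv_mul_eq_one] at this

omit [Fintype G] in
/-- Conversely, pairwise distinct columns force primitivity. -/
theorem isPrimitive_of_weight_injective {Φ : Finset G} (h : Function.Injective (weight Φ)) :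
    IsPrimitive Φ := by
  intro u hu
  have : weight Φ 1 = weight Φ u := by
    rw [weight_eq_weight_iff_mem_rstab, inv_one, one_mul, mem_rstab]
    exact hu
  exact (h this).symm

/-- The number of distinct columns of the μ-table of a primitive type is `|G|`. -/
theorem card_image_weight_of_isPrimitive {Φ : Finset G} (hΦ : IsPrimitive Φ) :
    (univ.image (weight Φ)).card = Fintype.card G := by
  rw [card_image_of_injective _ (weight_injective_of_isPrimitive hΦ), card_univ]

end HodgeRepro
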